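import Summits.NavierStokesRegularity.NavierStokesRegularity.Theorems.LerayQuarterDissipationFiniteDissipationLiouvilleHullCategory
import Summits.NavierStokesRegularity.NavierStokesRegularity.Theorems.LerayQuarterDissipationRecurrentReductionD
import Summits.NavierStokesRegularity.NavierStokesRegularity.Theorems.LerayQuarterDissipationFiniteDissipationLiouvillePastDss
import HarnessLib

/-!
# Crux `FiniteDissipationLiouville` (stmt-NavierStokesRegularity-22144), line `birth`:
# CATEGORY ON THE SCALING HULL — portrait clauses: no isolated counterexample; the
# DSS / wandering dichotomy; under the wall

Helper file (theorems only, `--supports` the crux), third of three, on top of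
`…HullCategory.exists_orbitLimit_off_orbits` (Baire on the compact scaling hull):

* `exists_orbitLimit_not_rescaling` — a uniformly recurrent member of `𝒟_{C,K}` that is not
  past-DSS has a scaling limit in `𝒟_{C,K}` off its own scaling orbit (the orbit is not closed);
* `exists_singular_orbitLimit_not_rescaling` — NO ISOLATED COUNTEREXAMPLE: for a SINGULAR such
  member (a wandering critical element of the crux) that limit is again SINGULAR
  (`RecurrentReductionD.persistent_singularity`);
* `pastDss_iff_orbitLimits_rescalings` — DICHOTOMY for uniformly recurrent members of `𝒟_{C,K}`:
  past-DSS ⟺ every scaling limit is, on the past, one of its own rescalings;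
* `exists_singular_orbitLimit_off_orbits` — the (v22) CATEGORY clause of the skeleton: a
  singular, uniformly recurrent, not past-DSS member has, for every sequence of fields, a
  SINGULAR scaling limit in `𝒟_{C,K}` on none of their scaling orbits;
* `exists_singular_orbitLimit_off_orbits_of_wall` — under the catalogued wall
  `∀ c>1, TypeIDSSLiouville c` every singular uniformly recurrent member is wandering
  (`…Birth.pastDssExclusion_of_typeIDSSLiouville`), so for every sequence of fields it has a
  SINGULAR scaling limit on none of their orbits: conditionally on the wall the residue of the
  crux is empty or uncountable modulo scaling.

No summit is proved by this file; Navier–Stokes regularity is NOT proved by anything here; the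
crux stays FRONTIER (blocked on `∀ c>1, TypeIDSSLiouville c`, NECESSARY by `…Hardness`).

References: H. Furstenberg, *Recurrence in Ergodic Theory and Combinatorial Number Theory* (1981),
Ch. 1 §4 (uniform recurrence, minimal sets) [Furstenberg1981]; G. Koch, N. Nadirashvili,
G. Seregin, V. Šverák, Acta Math. 203 (2009) = arXiv:0709.3599, §4 (compactness of the Type-I
class) [KochNadirashviliSereginSverak2009]; Z. Bradshaw, T.-P. Tsai, Comm. PDE 42 (2017), §5
OP 5.1 [BradshawTsai2017CPDE]. Baire's category theorem: Mathlib (`BaireSpace`).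
-/

noncomputable section

-- the summit and its single problem share the name (D-0017 nested layout)
set_option linter.dupNamespace false

namespace Summit.NavierStokesRegularity.NavierStokesRegularity.Theorems.FiniteDissipationLiouville.HullCategory

open scoped Topology
open MeasureTheory Set Function Filter Metric TopologicalSpace Topology
open Literature.Analysis.FluidPDE
open Literature.Dynamics.TopologicalDynamics
open Summit.NavierStokesRegularity.NavierStokesRegularity.Theorems.RecurrentReductionD

/-! ### §4 Corollaries: no isolated counterexample; the DSS / wandering dichotomy; under the wall -/

/-- **A wandering recurrent member has a scaling limit off its own orbit.** If `u ∈ 𝒟_{C,K}` is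
uniformly recurrent under the scaling flow and not past-DSS, some scaling limit `W ∈ 𝒟_{C,K}` of
`u` (uniform on the slab pieces, pointwise on the open past) differs on the past from EVERY
rescaling `u_c`, `c > 0` — the scaling orbit of `u` is not closed in its hull (the main theorem
with the constant sequence `V i = u`). [cite: Furstenberg1981, Ch. 1 §4 (minimal sets; recurrence)] -/
theorem exists_orbitLimit_not_rescaling {C K : ℝ}
    {u : ℝ → EuclideanSpace ℝ (Fin 3) → EuclideanSpace ℝ (Fin 3)}
    (hu : IsTypeIAncientMild C u)
    (hlaw : ∀ s : ℝ, s < 0 → ∫⁻ x, ‖fderiv ℝ (u s) x‖ₑ ^ 2 ≤ ENNReal.ofReal (K / Real.sqrt (-s)))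
    (hrec : ∀ ε > 0, ∀ R > 1, ∃ L > 0, ∀ a : ℝ, ∃ σ ∈ Icc a (a + L),
      ∀ s ∈ Icc (-(R ^ 2)) (-(R⁻¹) ^ 2), ∀ y ∈ closedBall (0 : EuclideanSpace ℝ (Fin 3)) R,
        ‖Real.exp σ • u (Real.exp (2 * σ) * s) (Real.exp σ • y) - u s y‖ ≤ ε)
    (hndss : ∀ c : ℝ, 1 < c → ¬ ∀ t : ℝ, t < 0 → ∀ x, c • u (c ^ 2 * t) (c • x) = u t x) :
    ∃ l : ℕ → ℝ, (∀ k, 0 < l k) ∧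
      ∃ W : ℝ → EuclideanSpace ℝ (Fin 3) → EuclideanSpace ℝ (Fin 3),
        IsTypeIAncientMild C W ∧
        (∀ s : ℝ, s < 0 → ∫⁻ x, ‖fderiv ℝ (W s) x‖ₑ ^ 2 ≤ ENNReal.ofReal (K / Real.sqrt (-s))) ∧
        (∀ n : ℕ, TendstoUniformlyOn (fun k z => nsRescale (l k) u z.1 z.2) (fun z => W z.1 z.2)
          atTop (Icc (-((n : ℝ) + 2)) (-(1 / ((n : ℝ) + 2))) ×ˢ
            closedBall (0 : EuclideanSpace ℝ (Fin 3)) ((n : ℝ) + 2))) ∧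
        (∀ t < 0, ∀ x, Tendsto (fun k => nsRescale (l k) u t x) atTop (𝓝 (W t x))) ∧
        ∀ c : ℝ, 0 < c → ∃ t : ℝ, t < 0 ∧ ∃ x, W t x ≠ nsRescale c u t x := by
  obtain ⟨l, hl, W, hW, hlawW, hWu, hpt, hoff⟩ :=
    exists_orbitLimit_off_orbits hu hlaw hrec hndss (fun _ => u) (fun _ => hu.continuousOn_uncurry)
  exact ⟨l, hl, W, hW, hlawW, hWu, hpt, hoff 0⟩

/-- **NO ISOLATED COUNTEREXAMPLE.** A SINGULAR, uniformly recurrent member of `𝒟_{C,K}` (a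
critical element of the crux) that is not past-DSS has a scaling limit `W ∈ 𝒟_{C,K}` which is
again SINGULAR at the origin (persistence of the apex singularity,
`RecurrentReductionD.persistent_singularity`) and is not, on the past, any rescaling of it: a
wandering counterexample to the crux never comes alone modulo scaling.
[cite: KochNadirashviliSereginSverak2009, §4 (arXiv:0709.3599 p. 8)] -/
theorem exists_singular_orbitLimit_not_rescaling {C K : ℝ}
    {u : ℝ → EuclideanSpace ℝ (Fin 3) → EuclideanSpace ℝ (Fin 3)}
    (hu : IsTypeIAncientMild C u)
    (hlaw : ∀ s : ℝ, s < 0 → ∫⁻ x, ‖fderiv ℝ (u s) x‖ₑ ^ 2 ≤ ENNReal.ofReal (K / Real.sqrt (-s)))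
    (hsing : ∀ r > 0, ∀ M : ℝ, ∃ t ∈ Ioo (-(r ^ 2)) (0 : ℝ),
      ∃ x ∈ ball (0 : EuclideanSpace ℝ (Fin 3)) r, M < ‖u t x‖)
    (hrec : ∀ ε > 0, ∀ R > 1, ∃ L > 0, ∀ a : ℝ, ∃ σ ∈ Icc a (a + L),
      ∀ s ∈ Icc (-(R ^ 2)) (-(R⁻¹) ^ 2), ∀ y ∈ closedBall (0 : EuclideanSpace ℝ (Fin 3)) R,
        ‖Real.exp σ • u (Real.exp (2 * σ) * s) (Real.exp σ • y) - u s y‖ ≤ ε)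
    (hndss : ∀ c : ℝ, 1 < c → ¬ ∀ t : ℝ, t < 0 → ∀ x, c • u (c ^ 2 * t) (c • x) = u t x) :
    ∃ W : ℝ → EuclideanSpace ℝ (Fin 3) → EuclideanSpace ℝ (Fin 3),
      IsTypeIAncientMild C W ∧
      (∀ s : ℝ, s < 0 → ∫⁻ x, ‖fderiv ℝ (W s) x‖ₑ ^ 2 ≤ ENNReal.ofReal (K / Real.sqrt (-s))) ∧
      (∀ r > 0, ∀ M : ℝ, ∃ t ∈ Ioo (-(r ^ 2)) (0 : ℝ),
        ∃ x ∈ ball (0 : EuclideanSpace ℝ (Fin 3)) r, M < ‖W t x‖) ∧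
      (∃ l : ℕ → ℝ, (∀ k, 0 < l k) ∧
        ∀ t < 0, ∀ x, Tendsto (fun k => nsRescale (l k) u t x) atTop (𝓝 (W t x))) ∧
      ∀ c : ℝ, 0 < c → ∃ t : ℝ, t < 0 ∧ ∃ x, W t x ≠ nsRescale c u t x := by
  obtain ⟨l, hl, W, hW, hlawW, hWu, hpt, hoff⟩ := exists_orbitLimit_not_rescaling hu hlaw hrec hndss
  exact ⟨W, hW, hlawW, persistent_singularity hu hlaw hsing l hl W hWu, ⟨l, hl, hpt⟩, hoff⟩

/-- **THE DSS / WANDERING DICHOTOMY on the hull of a recurrent member.** For a uniformly recurrent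
member `u ∈ 𝒟_{C,K}`: `u` is past-DSS with some factor `c > 1` IF AND ONLY IF every pointwise
scaling limit of `u` on the open past (along rescalings `u_{l_k}`, `l_k > 0`, uniform on the slab
pieces) is, on the past, one of its own rescalings — the scaling orbit is closed exactly in the
discretely self-similar case (`orbitLimit_eq_rescaling_of_pastDss` and
`exists_orbitLimit_not_rescaling`). [cite: Furstenberg1981, Ch. 1 §4 (minimal sets; recurrence)] -/
theorem pastDss_iff_orbitLimits_rescalings {C K : ℝ}
    {u : ℝ → EuclideanSpace ℝ (Fin 3) → EuclideanSpace ℝ (Fin 3)}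
    (hu : IsTypeIAncientMild C u)
    (hlaw : ∀ s : ℝ, s < 0 → ∫⁻ x, ‖fderiv ℝ (u s) x‖ₑ ^ 2 ≤ ENNReal.ofReal (K / Real.sqrt (-s)))
    (hrec : ∀ ε > 0, ∀ R > 1, ∃ L > 0, ∀ a : ℝ, ∃ σ ∈ Icc a (a + L),
      ∀ s ∈ Icc (-(R ^ 2)) (-(R⁻¹) ^ 2), ∀ y ∈ closedBall (0 : EuclideanSpace ℝ (Fin 3)) R,
        ‖Real.exp σ • u (Real.exp (2 * σ) * s) (Real.exp σ • y) - u s y‖ ≤ ε) :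
    (∃ c : ℝ, 1 < c ∧ ∀ t : ℝ, t < 0 → ∀ x, c • u (c ^ 2 * t) (c • x) = u t x) ↔
      ∀ (l : ℕ → ℝ), (∀ k, 0 < l k) →
        ∀ W : ℝ → EuclideanSpace ℝ (Fin 3) → EuclideanSpace ℝ (Fin 3),
          (∀ n : ℕ, TendstoUniformlyOn (fun k z => nsRescale (l k) u z.1 z.2) (fun z => W z.1 z.2)
            atTop (Icc (-((n : ℝ) + 2)) (-(1 / ((n : ℝ) + 2))) ×ˢ
              closedBall (0 : EuclideanSpace ℝ (Fin 3)) ((n : ℝ) + 2))) →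
          (∀ t < 0, ∀ x, Tendsto (fun k => nsRescale (l k) u t x) atTop (𝓝 (W t x))) →
          ∃ c : ℝ, 0 < c ∧ ∀ t : ℝ, t < 0 → ∀ x, W t x = nsRescale c u t x := by
  constructor
  · rintro ⟨c, hc, hdss⟩ l hl W - hpt
    obtain ⟨c₀, hc₀, hW⟩ :=
      orbitLimit_eq_rescaling_of_pastDss hc hu.continuousOn_uncurry hdss l hl W hpt
    exact ⟨c₀, one_pos.trans_le hc₀.1, hW⟩
  · intro h
    by_contra hndss
    push Not at hndss
    have hndss' : ∀ c : ℝ, 1 < c → ¬ ∀ t : ℝ, t < 0 → ∀ x, c • u (c ^ 2 * t) (c • x) = u t x :=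
      fun c hc hall => by
        obtain ⟨t, ht, x, hx⟩ := hndss c hc
        exact hx (hall t ht x)
    obtain ⟨l, hl, W, -, -, hWu, hpt, hoff⟩ := exists_orbitLimit_not_rescaling hu hlaw hrec hndss'
    obtain ⟨c, hc, hWc⟩ := h l hl W hWu hpt
    obtain ⟨t, ht, x, hx⟩ := hoff c hc
    exact hx (hWc t ht x)

/-- **A wandering critical element has SINGULAR scaling limits off any countable family of
scaling orbits** (the main theorem plus persistence of the apex singularity,
`RecurrentReductionD.persistent_singularity`): for `u ∈ 𝒟_{C,K}` singular, uniformly recurrent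
and not past-DSS, and any sequence of fields `V i` continuous on the open past, some scaling limit
`W ∈ 𝒟_{C,K}` of `u` is singular at the origin and agrees on the past with no rescaling of any
`V i`. This is the (v22) CATEGORY clause of the line's skeleton. [cite: KochNadirashviliSereginSverak2009, §4 (arXiv:0709.3599 p. 8)] -/
theorem exists_singular_orbitLimit_off_orbits {C K : ℝ}
    {u : ℝ → EuclideanSpace ℝ (Fin 3) → EuclideanSpace ℝ (Fin 3)}
    (hu : IsTypeIAncientMild C u)
    (hlaw : ∀ s : ℝ, s < 0 → ∫⁻ x, ‖fderiv ℝ (u s) x‖ₑ ^ 2 ≤ ENNReal.ofReal (K / Real.sqrt (-s)))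
    (hsing : ∀ r > 0, ∀ M : ℝ, ∃ t ∈ Ioo (-(r ^ 2)) (0 : ℝ),
      ∃ x ∈ ball (0 : EuclideanSpace ℝ (Fin 3)) r, M < ‖u t x‖)
    (hrec : ∀ ε > 0, ∀ R > 1, ∃ L > 0, ∀ a : ℝ, ∃ σ ∈ Icc a (a + L),
      ∀ s ∈ Icc (-(R ^ 2)) (-(R⁻¹) ^ 2), ∀ y ∈ closedBall (0 : EuclideanSpace ℝ (Fin 3)) R,
        ‖Real.exp σ • u (Real.exp (2 * σ) * s) (Real.exp σ • y) - u s y‖ ≤ ε)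
    (hndss : ∀ c : ℝ, 1 < c → ¬ ∀ t : ℝ, t < 0 → ∀ x, c • u (c ^ 2 * t) (c • x) = u t x)
    (V : ℕ → ℝ → EuclideanSpace ℝ (Fin 3) → EuclideanSpace ℝ (Fin 3))
    (hV : ∀ i, ContinuousOn (uncurry (V i)) (Iio 0 ×ˢ univ)) :
    ∃ W : ℝ → EuclideanSpace ℝ (Fin 3) → EuclideanSpace ℝ (Fin 3),
      IsTypeIAncientMild C W ∧
      (∀ s : ℝ, s < 0 → ∫⁻ x, ‖fderiv ℝ (W s) x‖ₑ ^ 2 ≤ ENNReal.ofReal (K / Real.sqrt (-s))) ∧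
      (∀ r > 0, ∀ M : ℝ, ∃ t ∈ Ioo (-(r ^ 2)) (0 : ℝ),
        ∃ x ∈ ball (0 : EuclideanSpace ℝ (Fin 3)) r, M < ‖W t x‖) ∧
      (∃ l : ℕ → ℝ, (∀ k, 0 < l k) ∧
        ∀ t < 0, ∀ x, Tendsto (fun k => nsRescale (l k) u t x) atTop (𝓝 (W t x))) ∧
      ∀ i : ℕ, ∀ c : ℝ, 0 < c → ∃ t : ℝ, t < 0 ∧ ∃ x, W t x ≠ nsRescale c (V i) t x := by
  obtain ⟨l, hl, W, hW, hlawW, hWu, hpt, hoff⟩ := exists_orbitLimit_off_orbits hu hlaw hrec hndss V hV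
  exact ⟨W, hW, hlawW, persistent_singularity hu hlaw hsing l hl W hWu, ⟨l, hl, hpt⟩, hoff⟩

/-- **Under the catalogued wall every critical element is wandering, so its hull is not covered by
countably many scaling orbits.** If `TypeIDSSLiouville c` holds for every `c > 1` (Bradshaw–Tsai
2017 OP 5.1 — NECESSARY for the crux, `…Hardness`), a SINGULAR uniformly recurrent member of
`𝒟_{C,K}` is not past-DSS (`…Birth.pastDssExclusion_of_typeIDSSLiouville`), hence for every
sequence of fields `V i` continuous on the open past it has a SINGULAR scaling limit in `𝒟_{C,K}`
on none of their scaling orbits: conditionally on the wall, the residue of the crux is empty or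
uncountable modulo scaling. [cite: BradshawTsai2017CPDE, §5 Open Problem 5.1] -/
theorem exists_singular_orbitLimit_off_orbits_of_wall
    (hwall : ∀ c : ℝ, 1 < c → TypeIDSSLiouville c) {C K : ℝ}
    {u : ℝ → EuclideanSpace ℝ (Fin 3) → EuclideanSpace ℝ (Fin 3)}
    (hu : IsTypeIAncientMild C u)
    (hlaw : ∀ s : ℝ, s < 0 → ∫⁻ x, ‖fderiv ℝ (u s) x‖ₑ ^ 2 ≤ ENNReal.ofReal (K / Real.sqrt (-s)))
    (hsing : ∀ r > 0, ∀ M : ℝ, ∃ t ∈ Ioo (-(r ^ 2)) (0 : ℝ),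
      ∃ x ∈ ball (0 : EuclideanSpace ℝ (Fin 3)) r, M < ‖u t x‖)
    (hrec : ∀ ε > 0, ∀ R > 1, ∃ L > 0, ∀ a : ℝ, ∃ σ ∈ Icc a (a + L),
      ∀ s ∈ Icc (-(R ^ 2)) (-(R⁻¹) ^ 2), ∀ y ∈ closedBall (0 : EuclideanSpace ℝ (Fin 3)) R,
        ‖Real.exp σ • u (Real.exp (2 * σ) * s) (Real.exp σ • y) - u s y‖ ≤ ε)
    (V : ℕ → ℝ → EuclideanSpace ℝ (Fin 3) → EuclideanSpace ℝ (Fin 3))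
    (hV : ∀ i, ContinuousOn (uncurry (V i)) (Iio 0 ×ˢ univ)) :
    ∃ W : ℝ → EuclideanSpace ℝ (Fin 3) → EuclideanSpace ℝ (Fin 3),
      IsTypeIAncientMild C W ∧
      (∀ s : ℝ, s < 0 → ∫⁻ x, ‖fderiv ℝ (W s) x‖ₑ ^ 2 ≤ ENNReal.ofReal (K / Real.sqrt (-s))) ∧
      (∀ r > 0, ∀ M : ℝ, ∃ t ∈ Ioo (-(r ^ 2)) (0 : ℝ),
        ∃ x ∈ ball (0 : EuclideanSpace ℝ (Fin 3)) r, M < ‖W t x‖) ∧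
      (∃ l : ℕ → ℝ, (∀ k, 0 < l k) ∧
        ∀ t < 0, ∀ x, Tendsto (fun k => nsRescale (l k) u t x) atTop (𝓝 (W t x))) ∧
      ∀ i : ℕ, ∀ c : ℝ, 0 < c → ∃ t : ℝ, t < 0 ∧ ∃ x, W t x ≠ nsRescale c (V i) t x :=
  exists_singular_orbitLimit_off_orbits hu hlaw hsing hrec
    (fun c hc hdss =>
      FiniteDissipationLiouville.Birth.pastDssExclusion_of_typeIDSSLiouville hwall C K c u hc hu hlaw
        hdss hsing) V hV

end Summit.NavierStokesRegularity.NavierStokesRegularity.Theorems.FiniteDissipationLiouville.HullCategory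

end
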